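import Literature.Probability.RandomPlanarGeometry.HexSAWSurfaceYcLimitAllY

/-!
# Honeycomb SAW at a surface: the wall-bridge rate IS the surface growth rate, `β(y) = μ(y)` for every `y > 0`
# (addendum 3 to `HexSAWSurfaceYcLimitAllY`)

Topic `Literature/Probability/RandomPlanarGeometry` (lane pcv-sawmu, door S1, ADDENDUM 3 by a-idea-1 g21 after the ed.4 freeze).
Part II defines `surfaceMu y := max (wallRate y) μ` and proves `C_n(y)^{1/n} → surfaceMu y`.  Here the `max` is removed:
**`wallRate_eq_surfaceMu : 0 < y → wallRate y = surfaceMu y`**, i.e. the Fekete growth rate `β(y)` of `y`-weighted WALL BRIDGES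
of the brick wall (Part I) equals `μ(y)` — Hammersley–Torrie–Whittington's "surface bridges have the same growth constant as
surface walks", Beaton's `μ(y)` = rate of unfolded surface walks (arXiv:1210.0274v3, Prop. 7 and eq. (16)).  In particular
`μ ≤ β(y)` for every `y > 0` and `β(y) = μ ↔ y ≤ 1+√2` (wall bridges in the desorbed phase grow at the bulk rate).

The missing inequality `μ(y) ≤ β(y)` is the MIRROR JOIN (HTW82 §2): unfold a half-plane walk by Part I's transpose-free
`G` (it keeps every `Y`-coordinate, hence the half-plane, the visits and the end height; `≤ e^{6√n}`-to-one), sort the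
unfolded walks `u` by their end height `-h` (`≤ 2n+1` classes), and join two of the same class as
`u₁ ⊕ (two steps) ⊕ revN u₂` — the time-reversed mirror image of `u₂` climbs back from height `-h` to the surface — which is a
wall bridge of length `2n+2` with `visits = v(u₁) + v(u₂) + 1` (`mjoin_spec`).  Hence
`y · C^w_n(y)² ≤ (2n+1)² e^{12√n} · B^w_{2n+2}(y)` (`mul_Cw_sq_le_WB`), and with Part II's sandwich `C_{n+1}(y) ≤ 3y C^w_n(y)`,
T5's `GrowthGeRate` below `μ(y)` and Part I's Fekete bound `B^w_m ≤ (β²/y) βᵐ` the sub-exponential factors are absorbed: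
`μ(y) ≤ β(y)` (`surfaceMu_le_wallRate`).

Sources. J. M. Hammersley, G. M. Torrie, S. G. Whittington, J. Phys. A 15 (1982) 539, §2; N. R. Beaton, J. Phys. A 47 (2014)
075003, Proposition 7 and eq. (16) (arXiv:1210.0274v3 p. 11); N. R. Beaton, M. Bousquet-Mélou, J. de Gier, H. Duminil-Copin,
A. J. Guttmann, CMP 326 (2014) 727, §3.1, Proposition 5 (arXiv:1109.0358v5 p. 9); N. Madras, G. Slade, The Self-Avoiding Walk
(1993), §1.2 and §3.1.
-/

noncomputable section

open Finset Filter Function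
open Literature.Probability.LatticeModels Literature.Probability.Percolation SimpleGraph
open Literature.Combinatorics.Enumerative
open _root_.Topology

namespace Literature.Probability.RandomPlanarGeometry.SAW.HexBW.Wall

variable {n : ℕ} {ω : ℕ → Site 2} {y : ℝ}

/-! ### Visits counted with time `0`; time reversal -/

/-- `V n ω` = the number of even times `s ∈ [0, n]` at which `ω` is on the wall. [folklore] -/
def V (n : ℕ) (ω : ℕ → Site 2) : ℕ := #((range (n + 1)).filter (fun s => s % 2 = 0 ∧ ω s 1 = 0))

/-- `V = visits + [time 0 is on the wall]`. [folklore]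
[cite: HammersleyTorrieWhittington1982, §2 (surface visits of unfolded walks); bookkeeping step of the mirror-join argument] -/
theorem V_eq (n : ℕ) (ω : ℕ → Site 2) : V n ω = visits n ω + (if ω 0 1 = 0 then 1 else 0) := by
  induction n with
  | zero =>
    unfold V
    rw [zero_add, Finset.range_one, Finset.filter_singleton]
    by_cases h : ω 0 1 = 0
    · simp [h]
    · simp [h]
  | succ n ih =>
    unfold V at ih ⊢
    rw [Finset.range_add_one, Finset.filter_insert, visits_succ]
    by_cases h : (n + 1) % 2 = 0 ∧ ω (n + 1) 1 = 0
    · rw [if_pos h, if_pos h, Finset.card_insert_of_notMem (by simp), ih]; omega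
    · rw [if_neg h, if_neg h, ih]; omega

/-- Time reversal does not change `V` (`n` even). [folklore]
[cite: HammersleyTorrieWhittington1982, §2 (time reversal of surface walks); bookkeeping step of the mirror-join argument] -/
theorem V_rev (hn : n % 2 = 0) (ω : ℕ → Site 2) : V n (fun t => ω (n - t)) = V n ω := by
  unfold V
  refine Finset.card_bij (fun t _ => n - t) (fun t ht => ?_) (fun t₁ h₁ t₂ h₂ e => ?_) (fun s hs => ?_)
  · simp only [Finset.mem_filter, Finset.mem_range] at ht ⊢
    exact ⟨by omega, by omega, ht.2.2⟩
  · simp only [Finset.mem_filter, Finset.mem_range] at h₁ h₂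
    omega
  · simp only [Finset.mem_filter, Finset.mem_range] at hs
    refine ⟨n - s, ?_, by omega⟩
    simp only [Finset.mem_filter, Finset.mem_range]
    exact ⟨by omega, by omega, by rw [Nat.sub_sub_self (by omega)]; exact hs.2.2⟩

/-! ### Unfolded half-plane walks and their end-height classes -/

open Classical in
/-- **Unfolded half-plane walks**: `hpw n` with `X` weakly minimal at the start and maximal at the end.
[cite: HammersleyTorrieWhittington1982, §2 (unfolded surface walks); Beaton2014RotatedHoneycomb, §3 (arXiv v3 p. 11)] -/
def uw (n : ℕ) : Finset (ℕ → Site 2) := (hpw n).filter (IsWB n)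

/-- Membership in `uw`. [folklore]
[cite: HammersleyTorrieWhittington1982, §2 (unfolded surface walks); bookkeeping step of the mirror-join argument] -/
theorem mem_uw : ω ∈ uw n ↔ ω ∈ hpw n ∧ IsWB n ω := by
  classical
  exact Finset.mem_filter

/-- Wall bridges are unfolded half-plane walks. [folklore]
[cite: HammersleyTorrieWhittington1982, §2 (surface bridges ⊆ unfolded surface walks); bookkeeping step of the mirror-join argument] -/
theorem wbr_subset_uw : wbr n ⊆ uw n := fun _ h =>
  mem_uw.2 ⟨archs_subset (wbr_subset h), (mem_wbr.1 h).2⟩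

/-- `U_n(y) = Σ_{u ∈ uw n} y^{visits}`. [cite: HammersleyTorrieWhittington1982, §2] -/
def Uw (n : ℕ) (y : ℝ) : ℝ := ∑ u ∈ uw n, y ^ visits n u

/-- The end-height class sum `U_n^{e}(y)` (`e = Y_n ≤ 0`). [cite: HammersleyTorrieWhittington1982, §2] -/
def Uf (n : ℕ) (e : ℤ) (y : ℝ) : ℝ := ∑ u ∈ (uw n).filter (fun u => u n 1 = e), y ^ visits n u

/-- `Uf ≥ 0`. [folklore]
[cite: HammersleyTorrieWhittington1982, §2 (end-height classes of unfolded walks); bookkeeping step of the mirror-join argument] -/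
theorem Uf_nonneg (n : ℕ) (e : ℤ) (hy : 0 ≤ y) : 0 ≤ Uf n e y := Finset.sum_nonneg fun _ _ => pow_nonneg hy _

/-- `G` maps half-plane walks to unfolded half-plane walks with the same visits and the same end height (`n` even).
[cite: HammersleyTorrieWhittington1982, §2; MadrasSlade1993, §3.1, Theorem 3.1.1] -/
theorem G_mem_uw (hω : ω ∈ hpw n) (hn : n % 2 = 0) :
    G n ω ∈ uw n ∧ visits n (G n ω) = visits n ω ∧ G n ω n 1 = ω n 1 := by
  obtain ⟨hωs, hhp⟩ := mem_hpw.1 hω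
  obtain ⟨hG, hwb, hY⟩ := G_spec hωs hn
  exact ⟨mem_uw.2 ⟨mem_hpw.2 ⟨hG, fun i hi => by rw [hY i hi]; exact hhp i hi⟩, hwb⟩,
    visits_congr fun i _ hi => hY i hi, hY n le_rfl⟩

open Classical in
/-- **`C^w_n(y) ≤ e^{6√n} · U_n(y)`** (`n` even): fibrewise in the number of visits, `G` is at most `e^{6√n}`-to-one from
half-plane walks into unfolded ones. [cite: HammersleyTorrieWhittington1982, §2; MadrasSlade1993, §3.1, Theorem 3.1.1] -/
theorem Cw_le_exp_mul_Uw (hy : 0 ≤ y) (hn : n % 2 = 0) : Cw n y ≤ Real.exp (6 * Real.sqrt n) * Uw n y := by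
  have hfC : ∀ ω ∈ hpw n, visits n ω ∈ range (n + 1) := fun ω _ =>
    Finset.mem_range.2 (Nat.lt_succ_of_le (visits_le n ω))
  have hfU : ∀ ω ∈ uw n, visits n ω ∈ range (n + 1) := fun ω _ =>
    Finset.mem_range.2 (Nat.lt_succ_of_le (visits_le n ω))
  rw [Cw, Uw, ← Finset.sum_fiberwise_of_maps_to hfC, ← Finset.sum_fiberwise_of_maps_to hfU, Finset.mul_sum]
  refine Finset.sum_le_sum fun v _ => ?_
  set FC := (hpw n).filter (fun ω => visits n ω = v)
  set FU := (uw n).filter (fun ω => visits n ω = v)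
  have hC : ∑ ω ∈ FC, y ^ visits n ω = #FC * y ^ v := by
    rw [Finset.sum_congr rfl fun ω hω => by rw [(Finset.mem_filter.1 hω).2], Finset.sum_const, nsmul_eq_mul]
  have hU : ∑ ω ∈ FU, y ^ visits n ω = #FU * y ^ v := by
    rw [Finset.sum_congr rfl fun ω hω => by rw [(Finset.mem_filter.1 hω).2], Finset.sum_const, nsmul_eq_mul]
  rw [hC, hU]
  have hT : FC ⊆ saws n := (Finset.filter_subset _ _).trans hpw_subset
  have himg : FC.image (G n) ⊆ FU := by
    intro ζ hζ
    obtain ⟨ω, hω, rfl⟩ := Finset.mem_image.1 hζ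
    obtain ⟨hωh, hv⟩ := Finset.mem_filter.1 hω
    obtain ⟨h1, h2, -⟩ := G_mem_uw hωh hn
    exact Finset.mem_filter.2 ⟨h1, by rw [h2, hv]⟩
  have h1 := card_le_exp_mul_card_image_G hT hn
  have h2 : (#(FC.image (G n)) : ℝ) ≤ #FU := by exact_mod_cast Finset.card_le_card himg
  calc (#FC : ℝ) * y ^ v ≤ (Real.exp (6 * Real.sqrt n) * #FU) * y ^ v := by
        refine mul_le_mul_of_nonneg_right (h1.trans ?_) (pow_nonneg hy _)
        exact mul_le_mul_of_nonneg_left h2 (Real.exp_nonneg _)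
    _ = Real.exp (6 * Real.sqrt n) * (#FU * y ^ v) := by ring

/-- `U_n(y)` is the sum of its end-height classes. [folklore]
[cite: HammersleyTorrieWhittington1982, §2 (pigeonhole over end heights); bookkeeping step of the mirror-join argument] -/
theorem Uw_eq_sum_Uf (n : ℕ) (y : ℝ) : Uw n y = ∑ e ∈ (uw n).image (fun u => u n 1), Uf n e y := by
  unfold Uw Uf
  exact (Finset.sum_fiberwise_of_maps_to (fun u hu => Finset.mem_image_of_mem _ hu) _).symm

/-- There are at most `2n+1` end-height classes. [folklore]
[cite: HammersleyTorrieWhittington1982, §2 (pigeonhole over end heights); bookkeeping step of the mirror-join argument] -/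
theorem card_image_end_le (n : ℕ) : #((uw n).image (fun u => u n 1)) ≤ 2 * n + 1 := by
  have hsub : (uw n).image (fun u => u n 1) ⊆ Finset.Icc (-(n : ℤ)) n := by
    intro e he
    obtain ⟨u, hu, rfl⟩ := Finset.mem_image.1 he
    have hus := hpw_subset (mem_uw.1 hu).1
    obtain ⟨h0, -, hadj, -⟩ := Zd.mem_saws.1 (saws_subset _ hus)
    have h := abs_le.1 (Zd.abs_apply_le_of_adj h0 hadj n le_rfl 1)
    exact Finset.mem_Icc.2 ⟨h.1, h.2⟩
  have hI : #(Finset.Icc (-(n : ℤ)) n) = 2 * n + 1 := by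
    rw [Int.card_Icc, show (n : ℤ) + 1 - -(n : ℤ) = ((2 * n + 1 : ℕ) : ℤ) by push_cast; ring, Int.toNat_natCast]
  exact (Finset.card_le_card hsub).trans hI.le

/-! ### The mirror join -/

/-- `revN` of an unfolded half-plane walk: a SAW from `0` with `0 ≤ X ≤ X_end`, `Y_j = Y_{n-j}(u) − Y_n(u)`.
[cite: HammersleyTorrieWhittington1982, §2] -/
theorem revN_uw {u : ℕ → Site 2} (hu : u ∈ uw n) (hn : n % 2 = 0) :
    revN n u ∈ saws n ∧ (∀ j ≤ n, 0 ≤ revN n u j 0 ∧ revN n u j 0 ≤ revN n u n 0) ∧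
      (∀ j, revN n u j 1 = u (n - j) 1 - u n 1) := by
  obtain ⟨huh, huwb⟩ := mem_uw.1 hu
  have hus := hpw_subset huh
  obtain ⟨hu0, -, -, -⟩ := mem_saws_iff.1 hus
  have hu00 : u 0 0 = 0 := by rw [hu0]; rfl
  refine ⟨revN_mem hus hn, fun j hj => ?_, fun j => revN_apply_one n u j⟩
  rw [revN_apply_zero, revN_apply_zero, Nat.sub_self, hu00, sub_zero]
  have h1 := huwb (n - j) (Nat.sub_le _ _)
  rw [hu00] at h1
  constructor <;> linarith [h1.1, h1.2]

/-- The tail piece of a SAW with `0 ≤ X ≤ X_end` (generalising `tailPiece_spec`): a brick-wall SAW with `1 ≤ X_i` for `i ≥ 1`,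
`0 ≤ X_i ≤ X_end`, and the stated `Y`-values. [cite: HammersleyTorrieWhittington1982, §2 (concatenation of surface bridges)] -/
theorem tailPiece_spec' {n₂ : ℕ} {υ : ℕ → Site 2} (hυs : υ ∈ saws n₂)
    (hXnn : ∀ j ≤ n₂, 0 ≤ υ j 0 ∧ υ j 0 ≤ υ n₂ 0) :
    tailPiece υ ∈ saws (2 + n₂) ∧ (∀ i, 1 ≤ i → i ≤ 2 + n₂ → 1 ≤ tailPiece υ i 0) ∧
      (∀ i ≤ 2 + n₂, 0 ≤ tailPiece υ i 0 ∧ tailPiece υ i 0 ≤ tailPiece υ (2 + n₂) 0) ∧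
      (∀ i ≤ 2, tailPiece υ i 1 = 0) ∧ (∀ j, tailPiece υ (2 + j) 1 = υ j 1) := by
  obtain ⟨h0, -, hbw, hinj⟩ := mem_saws_iff.1 hυs
  have hv : ∀ i ≤ 2 + n₂, (i ≤ 2 ∧ tailPiece υ i 0 = i ∧ tailPiece υ i 1 = 0) ∨
      (∃ j ≤ n₂, i = 2 + j ∧ tailPiece υ i 0 = 2 + υ j 0 ∧ tailPiece υ i 1 = υ j 1) := by
    intro i hi
    rcases le_or_gt i 2 with h2 | h2
    · exact Or.inl ⟨h2, tailPiece_apply_zero_of_le υ h2, tailPiece_apply_one_of_le υ h2⟩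
    · refine Or.inr ⟨i - 2, by omega, by omega, ?_, ?_⟩
      · rw [show i = 2 + (i - 2) by omega, tailPiece_apply_add_zero h0]; simp
      · rw [show i = 2 + (i - 2) by omega, tailPiece_apply_add_one h0]; simp
  refine ⟨?_, ?_, ?_, fun i hi => tailPiece_apply_one_of_le υ hi, fun j => tailPiece_apply_add_one h0 j⟩
  · have hsep : ∀ i ≤ 2, ∀ j, 1 ≤ j → j ≤ n₂ → Zd.straightWalk 2 2 i ≠ Zd.straightWalk 2 2 2 + υ j := by
      intro i hi j hj1 hj e
      have e0 := congrFun e 0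
      rw [Pi.add_apply, straightWalk_apply_zero, straightWalk_apply_zero, min_eq_left hi, min_self] at e0
      have hj0 := (hXnn j hj).1
      have hi2 : i = 2 := by push_cast at e0; omega
      subst hi2
      have hυj : υ j = 0 := by
        have : Zd.straightWalk 2 2 2 + υ j = Zd.straightWalk 2 2 2 + 0 := by rw [add_zero]; exact e.symm
        exact add_left_cancel this
      have := hinj (show j ∈ {i | i ≤ n₂} from hj) (show 0 ∈ {i | i ≤ n₂} from Nat.zero_le _) (by rw [hυj, h0])
      omega
    have hzd : tailPiece υ ∈ Zd.saws 2 (2 + n₂) := straight_concat_mem_zd 2 (saws_subset _ hυs) hsep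
    refine mem_saws.2 ⟨hzd, isBW_concatWalk (isBW_straight 2) hbw h0 ?_⟩
    rw [straightWalk_apply_zero, straightWalk_apply_one]; simp
  · intro i hi1 hi
    rcases hv i hi with ⟨-, h0', -⟩ | ⟨j, hj, -, h0', -⟩
    · rw [h0']; exact_mod_cast hi1
    · rw [h0']; linarith [(hXnn j hj).1]
  · have hlast : tailPiece υ (2 + n₂) 0 = 2 + υ n₂ 0 := tailPiece_apply_add_zero h0 n₂
    intro i hi
    rcases hv i hi with ⟨h2, h0', -⟩ | ⟨j, hj, -, h0', -⟩
    · rw [h0', hlast]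
      constructor
      · exact_mod_cast Nat.zero_le i
      · have : (i : ℤ) ≤ 2 := by exact_mod_cast h2
        linarith [(hXnn n₂ le_rfl).1]
    · rw [h0', hlast]
      constructor
      · linarith [(hXnn j hj).1]
      · linarith [(hXnn j hj).2]

/-- **The mirror join.** For unfolded half-plane walks `ω` (length `n₁`) and `u` (length `n₂`, both even) with the SAME end
height, `ω ⊕ (two steps) ⊕ revN u` is a wall bridge of length `n₁ + 2 + n₂` with `visits = v(ω) + v(u) + 1`: the time-reversed
mirror image of `u` climbs from the common end height back to the surface.
[cite: HammersleyTorrieWhittington1982, §2 (surface walks and surface bridges have the same growth constant); Beaton2014RotatedHoneycomb, Proposition 7 (arXiv v3 p. 11)] -/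
theorem mjoin_spec {n₁ n₂ : ℕ} {ω u : ℕ → Site 2} (hn₁ : n₁ % 2 = 0) (hn₂ : n₂ % 2 = 0)
    (hω : ω ∈ uw n₁) (hu : u ∈ uw n₂) (he : ω n₁ 1 = u n₂ 1) :
    jcat n₁ ω (revN n₂ u) ∈ wbr (n₁ + (2 + n₂)) ∧
      visits (n₁ + (2 + n₂)) (jcat n₁ ω (revN n₂ u)) = visits n₁ ω + visits n₂ u + 1 := by
  obtain ⟨hωh, hwb⟩ := mem_uw.1 hω
  obtain ⟨hωs, hhp⟩ := mem_hpw.1 hωh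
  obtain ⟨h0, -, hbw, -⟩ := mem_saws_iff.1 hωs
  obtain ⟨huh, -⟩ := mem_uw.1 hu
  obtain ⟨hus, huhp⟩ := mem_hpw.1 huh
  obtain ⟨hu0, -, -, -⟩ := mem_saws_iff.1 hus
  have hu01 : u 0 1 = 0 := by rw [hu0]; rfl
  obtain ⟨hυs, hυX, hυY⟩ := revN_uw hu hn₂
  set υ := revN n₂ u with hυdef
  obtain ⟨hT, hTX1, hTX, hTY0, hTY⟩ := tailPiece_spec' hυs hυX
  obtain ⟨hT0, -, hTbw, -⟩ := mem_saws_iff.1 hT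
  have hpar : (ω n₁ 0 + ω n₁ 1) % 2 = 0 := by
    have := parity_apply hωs le_rfl
    omega
  have he0 : ω n₁ 1 ≤ 0 := hhp n₁ le_rfl
  have hv1 : ∀ i ≤ n₁, jcat n₁ ω υ i = ω i := fun i hi => Zd.concatWalk_apply_of_le _ _ hi
  have hv2 : ∀ j, jcat n₁ ω υ (n₁ + j) = ω n₁ + tailPiece υ j := fun j => Zd.concatWalk_apply_add _ _ hT0 j
  have hmem : jcat n₁ ω υ ∈ saws (n₁ + (2 + n₂)) := by
    refine mem_saws.2 ⟨Zd.concatWalk_mem_saws (saws_subset _ hωs) (saws_subset _ hT) ?_,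
      isBW_concatWalk hbw hTbw hT0 hpar⟩
    intro i hi j hj1 hj e
    have e0 := congrFun e 0
    rw [Pi.add_apply] at e0
    have := (hwb i hi).2
    have := hTX1 j hj1 hj
    omega
  have hYt : ∀ j ≤ 2 + n₂, (ω n₁ + tailPiece υ j) 1 ≤ 0 := by
    intro j hj
    rw [Pi.add_apply]
    rcases le_or_gt j 2 with h2 | h2
    · rw [hTY0 j h2, add_zero]; exact he0
    · obtain ⟨t, rfl⟩ : ∃ t, j = 2 + t := ⟨j - 2, by omega⟩
      rw [hTY t, hυY t, he]
      have := huhp (n₂ - t) (Nat.sub_le _ _)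
      linarith
  have hend : (ω n₁ + tailPiece υ (2 + n₂)) 1 = 0 := by
    rw [Pi.add_apply, hTY n₂, hυY n₂, Nat.sub_self, hu01, he]; ring
  refine ⟨mem_wbr.2 ⟨mem_archs.2 ⟨mem_hpw.2 ⟨hmem, fun i hi => ?_⟩, ⟨by omega, ?_⟩⟩, fun i hi => ?_⟩, ?_⟩
  · rcases le_or_gt i n₁ with h | h
    · rw [hv1 i h]; exact hhp i h
    · rw [show i = n₁ + (i - n₁) by omega, hv2]; exact hYt _ (by omega)
  · rw [hv2]; exact hend
  · have hlast : jcat n₁ ω υ (n₁ + (2 + n₂)) 0 = ω n₁ 0 + tailPiece υ (2 + n₂) 0 := by rw [hv2, Pi.add_apply]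
    have hfirst : jcat n₁ ω υ 0 0 = ω 0 0 := by rw [hv1 0 (Nat.zero_le _)]
    rw [hlast, hfirst]
    rcases le_or_gt i n₁ with h | h
    · rw [hv1 i h]
      have := hwb i h
      have := (hTX (2 + n₂) le_rfl).1
      constructor <;> linarith
    · rw [show i = n₁ + (i - n₁) by omega, hv2, Pi.add_apply]
      have := hTX (i - n₁) (by omega)
      have := hwb n₁ le_rfl
      constructor <;> linarith
  · -- the visits
    have e1 : visits (n₁ + (2 + n₂)) (jcat n₁ ω υ) =
        visits n₁ (jcat n₁ ω υ) + visits (2 + n₂) (fun j => jcat n₁ ω υ (n₁ + j)) :=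
      visits_add hn₁ fun j _ _ => rfl
    have e2 : visits n₁ (jcat n₁ ω υ) = visits n₁ ω := visits_congr fun i _ hi => by rw [hv1 i hi]
    have e3 : visits (2 + n₂) (fun j => jcat n₁ ω υ (n₁ + j)) =
        visits 2 (fun j => jcat n₁ ω υ (n₁ + j)) + visits n₂ (fun t => jcat n₁ ω υ (n₁ + (2 + t))) :=
      visits_add (by decide) fun t _ _ => rfl
    have hJ2 : jcat n₁ ω υ (n₁ + 2) 1 = u n₂ 1 := by
      rw [hv2, Pi.add_apply, hTY0 2 le_rfl, add_zero, he]
    have e4 : visits 2 (fun j => jcat n₁ ω υ (n₁ + j)) = if u n₂ 1 = 0 then 1 else 0 := by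
      rw [visits_succ, visits_succ, visits_zero]
      simp [hJ2]
    have hJt : ∀ t, jcat n₁ ω υ (n₁ + (2 + t)) 1 = u (n₂ - t) 1 := fun t => by
      rw [hv2, Pi.add_apply, hTY t, hυY t, he]; ring
    have e5 : V n₂ (fun t => jcat n₁ ω υ (n₁ + (2 + t))) = V n₂ (fun t => u (n₂ - t)) := by
      unfold V
      congr 1
      exact Finset.filter_congr fun t _ => by simp only [hJt t]
    have e6 : V n₂ (fun t => jcat n₁ ω υ (n₁ + (2 + t))) =
        visits n₂ (fun t => jcat n₁ ω υ (n₁ + (2 + t))) + (if u n₂ 1 = 0 then 1 else 0) := by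
      have h := V_eq n₂ (fun t => jcat n₁ ω υ (n₁ + (2 + t)))
      simp only [hJ2] at h
      exact h
    have e7 : V n₂ u = visits n₂ u + 1 := by rw [V_eq, if_pos hu01]
    have e8 := V_rev hn₂ u
    rw [e1, e2, e3, e4]
    by_cases hc0 : u n₂ 1 = 0
    · rw [if_pos hc0] at e6 ⊢; omega
    · rw [if_neg hc0] at e6 ⊢; omega

/-- **`y · U_n^{e}(y)² ≤ B^w_{2n+2}(y)`**: the mirror join is injective on each end-height class.
[cite: HammersleyTorrieWhittington1982, §2; MadrasSlade1993, §1.2, (1.2.15)] -/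
theorem mul_Uf_sq_le_WB (hy : 0 ≤ y) (hn : n % 2 = 0) (e : ℤ) :
    y * Uf n e y ^ 2 ≤ WB (n + (2 + n)) y := by
  classical
  set F := (uw n).filter (fun u => u n 1 = e) with hFdef
  have hF : ∀ u ∈ F, u ∈ uw n ∧ u n 1 = e := fun u hu => Finset.mem_filter.1 hu
  have hinj : Set.InjOn (fun p : (ℕ → Site 2) × (ℕ → Site 2) => jcat n p.1 (revN n p.2)) ↑(F ×ˢ F) := by
    rintro ⟨ω, u⟩ hp ⟨ω', u'⟩ hp' h
    rw [Finset.mem_coe, Finset.mem_product] at hp hp'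
    dsimp only at h
    have hωs := hpw_subset (mem_uw.1 (hF _ hp.1).1).1
    have hω's := hpw_subset (mem_uw.1 (hF _ hp'.1).1).1
    have hus := hpw_subset (mem_uw.1 (hF _ hp.2).1).1
    have hu's := hpw_subset (mem_uw.1 (hF _ hp'.2).1).1
    obtain ⟨hυs, hυX, -⟩ := revN_uw (hF _ hp.2).1 hn
    obtain ⟨hυ's, hυ'X, -⟩ := revN_uw (hF _ hp'.2).1 hn
    have hT := (tailPiece_spec' hυs hυX).1
    have hT' := (tailPiece_spec' hυ's hυ'X).1
    obtain ⟨h1, h2⟩ := Zd.concatWalk_injective_pieces (saws_subset _ hωs) (saws_subset _ hT)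
      (saws_subset _ hω's) (saws_subset _ hT') h
    have h3 := tailPiece_injective (mem_saws_iff.1 hυs).1 (mem_saws_iff.1 hυ's).1 h2
    have h4 : u = u' := by
      have := congrArg (revN n) h3
      rwa [revN_revN (mem_saws_iff.1 hus).1 (mem_saws_iff.1 hus).2.1,
        revN_revN (mem_saws_iff.1 hu's).1 (mem_saws_iff.1 hu's).2.1] at this
    simp only [Prod.mk.injEq]
    exact ⟨h1, h4⟩
  have hspec : ∀ p ∈ F ×ˢ F, jcat n p.1 (revN n p.2) ∈ wbr (n + (2 + n)) ∧
      visits (n + (2 + n)) (jcat n p.1 (revN n p.2)) = visits n p.1 + visits n p.2 + 1 := by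
    intro p hp
    rw [Finset.mem_product] at hp
    exact mjoin_spec hn hn (hF _ hp.1).1 (hF _ hp.2).1 ((hF _ hp.1).2.trans (hF _ hp.2).2.symm)
  calc y * Uf n e y ^ 2 = y * Uf n e y * Uf n e y := by ring
    _ = ∑ ω ∈ F, ∑ u ∈ F, y * y ^ visits n ω * y ^ visits n u := by
        simp only [Uf, ← hFdef, Finset.mul_sum, Finset.sum_mul]
        exact Finset.sum_comm
    _ = ∑ ω ∈ F, ∑ u ∈ F, y ^ (visits n ω + visits n u + 1) := by
        refine Finset.sum_congr rfl fun ω _ => Finset.sum_congr rfl fun u _ => ?_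
        ring
    _ = ∑ p ∈ F ×ˢ F, y ^ visits (n + (2 + n)) (jcat n p.1 (revN n p.2)) := by
        rw [Finset.sum_product]
        refine Finset.sum_congr rfl fun ω hω => Finset.sum_congr rfl fun u hu => ?_
        rw [(hspec (ω, u) (Finset.mem_product.2 ⟨hω, hu⟩)).2]
    _ = ∑ ζ ∈ (F ×ˢ F).image (fun p => jcat n p.1 (revN n p.2)), y ^ visits (n + (2 + n)) ζ :=
        (Finset.sum_image (f := fun ζ => y ^ visits (n + (2 + n)) ζ) hinj).symm
    _ ≤ WB (n + (2 + n)) y := by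
        refine Finset.sum_le_sum_of_subset_of_nonneg (fun ζ hζ => ?_) fun _ _ _ => pow_nonneg hy _
        obtain ⟨p, hp, rfl⟩ := Finset.mem_image.1 hζ
        exact (hspec p hp).1

/-- **`y · C^w_n(y)² ≤ (2n+1)² e^{12√n} · B^w_{2n+2}(y)`** (`n` even): unfold, pick the largest end-height class, mirror-join.
[cite: HammersleyTorrieWhittington1982, §2; Beaton2014RotatedHoneycomb, Proposition 7 (arXiv v3 p. 11)] -/
theorem mul_Cw_sq_le_WB (hy : 0 ≤ y) (hn : n % 2 = 0) :
    y * Cw n y ^ 2 ≤ (2 * n + 1) ^ 2 * Real.exp (12 * Real.sqrt n) * WB (n + (2 + n)) y := by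
  set E := (uw n).image (fun u => u n 1) with hEdef
  have hE : E.Nonempty := by
    obtain ⟨j, rfl⟩ : ∃ j, n = 2 * j := ⟨n / 2, by omega⟩
    exact ⟨_, Finset.mem_image_of_mem _ (wbr_subset_uw (straightWalk_mem_wbr j))⟩
  obtain ⟨e, -, hmax⟩ := Finset.exists_max_image E (fun e => Uf n e y) hE
  have hU : Uw n y ≤ (2 * n + 1) * Uf n e y := by
    rw [Uw_eq_sum_Uf]
    calc ∑ e' ∈ E, Uf n e' y ≤ ∑ e' ∈ E, Uf n e y := Finset.sum_le_sum fun e' he' => hmax e' he'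
      _ = #E * Uf n e y := by rw [Finset.sum_const, nsmul_eq_mul]
      _ ≤ (2 * n + 1) * Uf n e y := by
          refine mul_le_mul_of_nonneg_right ?_ (Uf_nonneg n e hy)
          exact_mod_cast card_image_end_le n
  have hle : Cw n y ≤ Real.exp (6 * Real.sqrt n) * ((2 * n + 1) * Uf n e y) :=
    (Cw_le_exp_mul_Uw hy hn).trans (mul_le_mul_of_nonneg_left hU (Real.exp_nonneg _))
  have hexp : Real.exp (6 * Real.sqrt n) ^ 2 = Real.exp (12 * Real.sqrt n) := by
    rw [sq, ← Real.exp_add]; congr 1; ring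
  calc y * Cw n y ^ 2 ≤ y * (Real.exp (6 * Real.sqrt n) * ((2 * n + 1) * Uf n e y)) ^ 2 :=
        mul_le_mul_of_nonneg_left (pow_le_pow_left₀ (Cw_nonneg n hy) hle 2) hy
    _ = (2 * n + 1) ^ 2 * Real.exp (12 * Real.sqrt n) * (y * Uf n e y ^ 2) := by rw [← hexp]; ring
    _ ≤ (2 * n + 1) ^ 2 * Real.exp (12 * Real.sqrt n) * WB (n + (2 + n)) y :=
        mul_le_mul_of_nonneg_left (mul_Uf_sq_le_WB hy hn e) (by positivity)

end Literature.Probability.RandomPlanarGeometry.SAW.HexBW.Wall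

namespace Literature.Probability.RandomPlanarGeometry.SAW.HV

open Literature.Probability.RandomPlanarGeometry.SAW.HexBW.Wall

variable {y : ℝ}

/-- `(2n+1)² ≤ 4 e^{4√n}`. [folklore]
[cite: HammersleyTorrieWhittington1982, §2 (polynomial factors are absorbed in e^{O(√n)}; lane numeral); bookkeeping step of the mirror-join argument] -/
theorem sq_two_mul_add_one_le_exp (n : ℕ) : ((2 : ℝ) * n + 1) ^ 2 ≤ 4 * Real.exp (4 * Real.sqrt n) := by
  have hn0 : (0 : ℝ) ≤ n := Nat.cast_nonneg n
  have hs0 : 0 ≤ Real.sqrt (n : ℝ) := Real.sqrt_nonneg _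
  have hsq : Real.sqrt (n : ℝ) ^ 2 = n := Real.sq_sqrt hn0
  have h := Real.quadratic_le_exp_of_nonneg (show 0 ≤ 2 * Real.sqrt (n : ℝ) by positivity)
  have h2 : (2 * Real.sqrt (n : ℝ)) ^ 2 / 2 = 2 * n := by rw [mul_pow, hsq]; ring
  rw [h2] at h
  have hn1 : (n : ℝ) + 1 ≤ Real.exp (2 * Real.sqrt n) := by linarith
  have hexp4 : Real.exp (2 * Real.sqrt (n : ℝ)) ^ 2 = Real.exp (4 * Real.sqrt n) := by
    rw [sq, ← Real.exp_add]; congr 1; ring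
  have h3 : ((2 : ℝ) * n + 1) ^ 2 ≤ (2 * (n + 1)) ^ 2 := pow_le_pow_left₀ (by positivity) (by linarith) 2
  have h4 : ((n : ℝ) + 1) ^ 2 ≤ Real.exp (2 * Real.sqrt n) ^ 2 := pow_le_pow_left₀ (by positivity) hn1 2
  calc ((2 : ℝ) * n + 1) ^ 2 ≤ (2 * (n + 1)) ^ 2 := h3
    _ = 4 * ((n : ℝ) + 1) ^ 2 := by ring
    _ ≤ 4 * Real.exp (2 * Real.sqrt n) ^ 2 := by linarith
    _ = 4 * Real.exp (4 * Real.sqrt n) := by rw [hexp4]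

/-- The algebra of the mirror-join bound at one even length `n = 2N`: if `r^{n+1} ≤ C_{n+1}(y)` (`r > 0`) then
`((r/β(y))²)^{n+1} ≤ 36 β(y)² e^{16√n}` — Part II's sandwich, `mul_Cw_sq_le_WB` and Part I's Fekete bound `B^w_m ≤ (β²/y) βᵐ`.
[cite: HammersleyTorrieWhittington1982, §2] -/
theorem rate_sq_pow_le {r : ℝ} (hy : 0 < y) (hr0 : 0 < r) {N : ℕ}
    (hA : r ^ (2 * N + 1) ≤ hpCoeff (2 * N + 1) y) :
    ((r / wallRate y) ^ 2) ^ (2 * N + 1) ≤ 36 * wallRate y ^ 2 * Real.exp (16 * Real.sqrt ((2 * N : ℕ) : ℝ)) := by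
  set n := 2 * N with hndef
  set β := wallRate y with hβdef
  have hβ : 0 < β := wallRate_pos y
  have hn : n % 2 = 0 := by omega
  have hCw : r ^ (n + 1) ≤ 3 * y * Cw n y := hA.trans (hpCoeff_succ_le n hy.le)
  have hkey := mul_Cw_sq_le_WB hy.le hn
  have hWB := WB_le_pow hy (n + (2 + n))
  have hpoly := sq_two_mul_add_one_le_exp n
  have hE16 : Real.exp (4 * Real.sqrt (n : ℝ)) * Real.exp (12 * Real.sqrt n) = Real.exp (16 * Real.sqrt n) := by
    rw [← Real.exp_add]; congr 1; ring
  have hP0 : (0 : ℝ) ≤ (2 * n + 1) ^ 2 * Real.exp (12 * Real.sqrt n) := by positivity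
  have hy2 : (0 : ℝ) ≤ 9 * y ^ 2 := by positivity
  have s1 : (r ^ (n + 1)) ^ 2 ≤ (3 * y * Cw n y) ^ 2 := pow_le_pow_left₀ (pow_nonneg hr0.le _) hCw 2
  have s2 : y * (3 * y * Cw n y) ^ 2 = 9 * y ^ 2 * (y * Cw n y ^ 2) := by ring
  have s3 : y * (r ^ (n + 1)) ^ 2 ≤
      9 * y ^ 2 * ((2 * n + 1) ^ 2 * Real.exp (12 * Real.sqrt n) * (β ^ 2 / y * β ^ (n + (2 + n)))) :=
    calc y * (r ^ (n + 1)) ^ 2 ≤ y * (3 * y * Cw n y) ^ 2 := mul_le_mul_of_nonneg_left s1 hy.le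
      _ = 9 * y ^ 2 * (y * Cw n y ^ 2) := s2
      _ ≤ 9 * y ^ 2 * ((2 * n + 1) ^ 2 * Real.exp (12 * Real.sqrt n) * WB (n + (2 + n)) y) :=
          mul_le_mul_of_nonneg_left hkey hy2
      _ ≤ _ := mul_le_mul_of_nonneg_left (mul_le_mul_of_nonneg_left hWB hP0) hy2
  have hyc : y * (β ^ 2 / y) = β ^ 2 := mul_div_cancel₀ _ hy.ne'
  have s4 : 9 * y ^ 2 * ((2 * n + 1) ^ 2 * Real.exp (12 * Real.sqrt n) * (β ^ 2 / y * β ^ (n + (2 + n)))) =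
      y * (9 * (2 * n + 1) ^ 2 * Real.exp (12 * Real.sqrt n) * β ^ 2 * β ^ (n + (2 + n))) :=
    calc 9 * y ^ 2 * ((2 * n + 1) ^ 2 * Real.exp (12 * Real.sqrt n) * (β ^ 2 / y * β ^ (n + (2 + n))))
          = 9 * y * (y * (β ^ 2 / y)) * ((2 * n + 1) ^ 2 * Real.exp (12 * Real.sqrt n) * β ^ (n + (2 + n))) := by
            ring
      _ = _ := by rw [hyc]; ring
  have s5 : (r ^ (n + 1)) ^ 2 ≤ 9 * (2 * n + 1) ^ 2 * Real.exp (12 * Real.sqrt n) * β ^ 2 * β ^ (n + (2 + n)) :=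
    le_of_mul_le_mul_left (s3.trans_eq s4) hy
  have s6 : (r ^ (n + 1)) ^ 2 ≤ 36 * β ^ 2 * Real.exp (16 * Real.sqrt n) * β ^ (n + (2 + n)) := by
    have hβm : 0 ≤ β ^ (n + (2 + n)) := pow_nonneg hβ.le _
    have h' : 9 * ((2 : ℝ) * n + 1) ^ 2 * Real.exp (12 * Real.sqrt n) ≤
        9 * (4 * Real.exp (4 * Real.sqrt n)) * Real.exp (12 * Real.sqrt n) :=
      mul_le_mul_of_nonneg_right (mul_le_mul_of_nonneg_left hpoly (by norm_num)) (Real.exp_nonneg _)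
    calc (r ^ (n + 1)) ^ 2 ≤ 9 * (2 * n + 1) ^ 2 * Real.exp (12 * Real.sqrt n) * β ^ 2 * β ^ (n + (2 + n)) := s5
      _ ≤ 9 * (4 * Real.exp (4 * Real.sqrt n)) * Real.exp (12 * Real.sqrt n) * β ^ 2 * β ^ (n + (2 + n)) :=
          mul_le_mul_of_nonneg_right (mul_le_mul_of_nonneg_right h' (sq_nonneg β)) hβm
      _ = 36 * β ^ 2 * Real.exp (16 * Real.sqrt n) * β ^ (n + (2 + n)) := by rw [← hE16]; ring
  have hrs : r ^ 2 = (r / β) ^ 2 * β ^ 2 := by rw [div_pow, div_mul_cancel₀ _ (pow_ne_zero 2 hβ.ne')]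
  have hL : (r ^ (n + 1)) ^ 2 = ((r / β) ^ 2) ^ (n + 1) * (β ^ 2) ^ (n + 1) := by
    rw [← mul_pow, ← hrs, ← pow_mul, ← pow_mul, mul_comm]
  have hR : β ^ (n + (2 + n)) = (β ^ 2) ^ (n + 1) := by
    rw [← pow_mul]; congr 1; ring
  rw [hL, hR] at s6
  have hβ2 : 0 < (β ^ 2) ^ (n + 1) := pow_pos (pow_pos hβ 2) _
  refine le_of_mul_le_mul_right ?_ hβ2
  calc ((r / β) ^ 2) ^ (n + 1) * (β ^ 2) ^ (n + 1) ≤ 36 * β ^ 2 * Real.exp (16 * Real.sqrt n) * (β ^ 2) ^ (n + 1) := s6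
    _ = 36 * β ^ 2 * Real.exp (16 * Real.sqrt n) * (β ^ 2) ^ (n + 1) := rfl

/-- **`μ(y) ≤ β(y)`**: the surface growth rate is at most the wall-bridge rate (HTW82 §2: sub-exponential factors absorbed).
[cite: HammersleyTorrieWhittington1982, §2; Beaton2014RotatedHoneycomb, Proposition 7 and eq. (16) (arXiv v3 p. 11)] -/
theorem surfaceMu_le_wallRate (hy : 0 < y) : surfaceMu y ≤ wallRate y := by
  refine le_of_forall_lt_imp_le_of_dense fun r hr => ?_
  rcases le_or_gt r 0 with hr0 | hr0
  · exact hr0.trans (wallRate_pos y).le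
  by_contra hlt
  rw [not_le] at hlt
  have hβ : 0 < wallRate y := wallRate_pos y
  have hq : 1 < r / wallRate y := (one_lt_div hβ).2 hlt
  have hs : 1 < (r / wallRate y) ^ 2 := one_lt_pow₀ hq two_ne_zero
  have hge := growthGeRate_surfaceMu hy
  have h1 := (tendsto_add_atTop_nat 1).eventually (hge r hr0.le hr)
  have h2 := eventually_mul_exp_sqrt_le_pow hs (36 * wallRate y ^ 2 + 1) 16
  obtain ⟨N, hN⟩ := Filter.eventually_atTop.1 (h1.and h2)
  obtain ⟨hA, hB⟩ := hN (2 * N) (by omega)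
  have s8 : ((r / wallRate y) ^ 2) ^ (2 * N) ≤ ((r / wallRate y) ^ 2) ^ (2 * N + 1) :=
    pow_le_pow_right₀ hs.le (Nat.le_succ _)
  have hfin := hB.trans (s8.trans (rate_sq_pow_le hy hr0 hA))
  have hlt' : 36 * wallRate y ^ 2 * Real.exp (16 * Real.sqrt ((2 * N : ℕ) : ℝ)) <
      (36 * wallRate y ^ 2 + 1) * Real.exp (16 * Real.sqrt ((2 * N : ℕ) : ℝ)) := by
    rw [add_mul, one_mul]; exact lt_add_of_pos_right _ (Real.exp_pos _)
  exact absurd hfin (not_le.2 hlt')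

/-- **`β(y) = μ(y)` for every `y > 0`: the wall-bridge rate is the surface growth rate** (so `surfaceMu`'s `max` is `β(y)` itself).
[cite: HammersleyTorrieWhittington1982, §2; Beaton2014RotatedHoneycomb, Proposition 7 and eq. (16) (arXiv v3 p. 11: μ(y) as the growth rate of unfolded walks); BeatonBousquetMelouDeGierDuminilCopinGuttmann2014, §3.1, Proposition 5] -/
theorem wallRate_eq_surfaceMu (hy : 0 < y) : wallRate y = surfaceMu y :=
  le_antisymm (wallRate_le_surfaceMu y) (surfaceMu_le_wallRate hy)

/-- **`μ ≤ β(y)` for every `y > 0`.** [cite: HammersleyTorrieWhittington1982, §2] -/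
theorem hexConnectiveConstant_le_wallRate (hy : 0 < y) : hexConnectiveConstant ≤ wallRate y := by
  rw [wallRate_eq_surfaceMu hy]; exact le_max_right _ _

/-- **`C_n(y)^{1/n} → β(y)`**: Prop. 5's limit is the wall-bridge rate. [cite: BeatonBousquetMelouDeGierDuminilCopinGuttmann2014, §3.1, Proposition 5 (arXiv v5 p. 9); Beaton2014RotatedHoneycomb, eq. (16) (arXiv v3 p. 11)] -/
theorem tendsto_hpCoeff_rpow_wallRate (hy : 0 < y) :
    Tendsto (fun n : ℕ => hpCoeff n y ^ ((n : ℝ)⁻¹)) atTop (𝓝 (wallRate y)) := by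
  rw [wallRate_eq_surfaceMu hy]; exact tendsto_hpCoeff_rpow hy

/-- **`β(y) = μ ↔ y ≤ 1+√2`**: in the desorbed phase wall bridges grow at the bulk rate; above `y_c` strictly faster.
[cite: BeatonBousquetMelouDeGierDuminilCopinGuttmann2014, §3.1, Proposition 5 and Theorem (y_c = 1+√2); HammersleyTorrieWhittington1982, §2] -/
theorem wallRate_eq_hexConnectiveConstant_iff (hy : 0 < y) :
    wallRate y = hexConnectiveConstant ↔ y ≤ 1 + Real.sqrt 2 := by
  rw [wallRate_eq_surfaceMu hy]; exact surfaceMu_eq_iff hy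

/-! ### Explicit finite-size sandwich at the true rate `β(y)` -/

/-- Lower half of the sandwich: `y·B^w_n(y) ≤ C_{n+1}(y)` (wall bridges are half-plane walks; dictionary of Part II).
[cite: HammersleyTorrieWhittington1982, §2] -/
theorem mul_WB_le_hpCoeff_succ (hy : 0 ≤ y) (n : ℕ) : y * WB n y ≤ hpCoeff (n + 1) y :=
  (mul_le_mul_of_nonneg_left (WB_le_Cw n hy) hy).trans (mul_Cw_le_hpCoeff_succ n hy)

/-- **Explicit finite-size upper bound at the TRUE rate** (no `ε`, no "eventually"): for `n` even,
`C_{n+1}(y) ≤ 3(2n+1)·e^{6√n}·β(y)^{n+2}` — the free energy per step of an `(n+1)`-step surface walk exceeds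
`log β(y)` by at most `O(n^{-1/2})`; together with `mul_WB_le_hpCoeff_succ` and Fekete (`WB_le_pow`):
`y·B^w_n(y) ≤ C_{n+1}(y) ≤ 3(2n+1)e^{6√n}β(y)^{n+2}` and `B^w_n(y) ≤ (β²/y)βⁿ`.
[cite: HammersleyTorrieWhittington1982, §2; MadrasSlade1993, §3.1 (Hammersley–Welsh-type sub-exponential corrections)] -/
theorem hpCoeff_succ_le_explicit (hy : 0 < y) {n : ℕ} (hn : n % 2 = 0) :
    hpCoeff (n + 1) y ≤ 3 * (2 * n + 1) * Real.exp (6 * Real.sqrt n) * wallRate y ^ (n + 2) := by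
  have hβ : 0 < wallRate y := wallRate_pos y
  have h1 : hpCoeff (n + 1) y ≤ 3 * y * Cw n y := hpCoeff_succ_le n hy.le
  have hkey := mul_Cw_sq_le_WB hy.le hn
  have hWB := WB_le_pow hy (n + (2 + n))
  have hC0 := hpCoeff_nonneg (n + 1) hy.le
  have hR0 : 0 ≤ 3 * (2 * n + 1) * Real.exp (6 * Real.sqrt n) * wallRate y ^ (n + 2) :=
    mul_nonneg (by positivity) (pow_nonneg hβ.le _)
  have hyc : y * (wallRate y ^ 2 / y) = wallRate y ^ 2 := mul_div_cancel₀ _ hy.ne'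
  have hexp : Real.exp (6 * Real.sqrt n) ^ 2 = Real.exp (12 * Real.sqrt n) := by
    rw [sq, ← Real.exp_add]; congr 1; ring
  have hP0 : (0 : ℝ) ≤ (2 * n + 1) ^ 2 * Real.exp (12 * Real.sqrt n) := by positivity
  refine (pow_le_pow_iff_left₀ hC0 hR0 two_ne_zero).1 ?_
  calc hpCoeff (n + 1) y ^ 2 ≤ (3 * y * Cw n y) ^ 2 := pow_le_pow_left₀ hC0 h1 2
    _ = 9 * y * (y * Cw n y ^ 2) := by ring
    _ ≤ 9 * y * ((2 * n + 1) ^ 2 * Real.exp (12 * Real.sqrt n) * WB (n + (2 + n)) y) :=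
        mul_le_mul_of_nonneg_left hkey (by positivity)
    _ ≤ 9 * y * ((2 * n + 1) ^ 2 * Real.exp (12 * Real.sqrt n) *
          (wallRate y ^ 2 / y * wallRate y ^ (n + (2 + n)))) :=
        mul_le_mul_of_nonneg_left (mul_le_mul_of_nonneg_left hWB hP0) (by positivity)
    _ = 9 * (y * (wallRate y ^ 2 / y)) *
          ((2 * n + 1) ^ 2 * Real.exp (12 * Real.sqrt n) * wallRate y ^ (n + (2 + n))) := by ring
    _ = (3 * (2 * n + 1) * Real.exp (6 * Real.sqrt n) * wallRate y ^ (n + 2)) ^ 2 := by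
        rw [hyc, ← hexp]; ring


end Literature.Probability.RandomPlanarGeometry.SAW.HV
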